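import Summits.ValiantsHypothesis.ValiantsHypothesis.Theorems.LacunarySymmetroidMatrixDescartesCensusDoorA34SheetSemidefBranches
import Summits.ValiantsHypothesis.ValiantsHypothesis.Theorems.LacunarySymmetroidMatrixDescartesCensusDoorA34SheetHyperbolicBlocks

/-!
# `MatrixDescartes` census — DOOR A at `(3,4)`: NO SEVENTEEN WITHOUT THE INTERACTION TERM — on the DECOUPLED-FRAME sub-stratum of the sheet
# (`vᵀ adj(G) w ≡ 0` for the top letter's two-graft frame) the count is `≤ 16`, for ALL supports and BOTH inertia cells

HONEST FRAMING.  Object-search cell `pub-symmetroid`, engine seat `val-sym-eng-2` (g9); helper row beside the registered strata line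
`Cruxes/DoorA34/Lines/strata.lean` on stmt-ValiantsHypothesis-19980 (`DoorA34 = PosRootLawAt 3 4 18`: OPEN, typed, never asserted here), stub `stub_nullTopCeiling`
(`det S₃ = 0 ⇒ ≤ 17`).  A rank-two top letter is two rank-one grafts, `S₃ = a·vvᵀ + b·wwᵀ` (…SheetTwoGrafts; semidefinite cell `ab > 0`, indefinite `ab < 0`), and by
…SheetSemidefBranches the Gram matrix of `adj F` on the frame `(v, w)` has diagonal entries `A = q_v + b·X^{d₃}·T`, `B = q_w + a·X^{d₃}·T` (nine-nomials) and the
GRAFT-FREE off-diagonal `m = vᵀ adj(G) w` (a six-nomial of the three-letter core), with Jacobi `A·B − m² = det F · T` (`T = kᵀGk`, `k = v × w`).  This file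
proves the polynomial-level identity and its one counting consequence:

* `map_C_two_grafts`, `pencil_two_grafts_eq` — bookkeeping: the `(3,4)` pencil over `ℝ[X]` is the core plus the two grafts at scale `X^{d₃}`;
* `gramDiag_left/right_eq`, `gramOffDiag_eq_core`, `gram_identity_pencil` — the polynomial forms of the graft identities and of Jacobi;
* `support_gramDiag_left/right_subset`, `card_nineExponents_le`, `card_posRoots_le_eight_of_support_nine` — each diagonal Gram entry lives on the six pair sums
  of the core plus the three exponents `d₃ + d_l`: at most nine monomials, hence at most EIGHT positive roots (sparse Descartes);
* **`card_posRoots_le_16_of_decoupledFrame`** — if the interaction term vanishes identically, `vᵀ adj(G(X)) w = 0` (six coefficient conditions on the core and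
  the frame: the DECOUPLED-FRAME sub-stratum), then `det F · T = A·B` splits, every positive det-root of `F` is a root of `A` or of `B`, and
  `Z₊(det F) ≤ 8 + 8 = 16` (the two non-degeneracy hypotheses `A ≠ 0`, `B ≠ 0` are explicit);
* `card_posRoots_le_16_of_decoupledFrame'` — the same with the top letter given as `S 3 = a·vvᵀ + b·wwᵀ` inside a `(3,4)` pencil `Σ_l X^{d_l} S_l`.
* §5 (rev 2, g10) `support_det_subset_of_topForm_eq_zero`, `card_posRoots_le_15_of_topForm_eq_zero` (the isotropic-kernel corner `k̂ᵀGk̂ ≡ 0`: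
  `≤ 16` monomials, `≤ 15` roots) and **`card_posRoots_le_16_of_decoupledFrame_closed`** — the count `≤ 16` with NO non-degeneracy hypothesis
  (a vanishing diagonal Gram entry forces `det P ≡ 0` or the corner, by Jacobi).

READING.  The located verdict of this seat's census (report DOOR-A34-ENG2G9 §2d): in the CANCELLATION regime the two rank-one truncations carry 1–8 roots while
`F` carries 15–16 — the roots are born from the interaction term `m`; in the WINDOW regime the dominant truncation carries 13–14 and the top window adds 2–3.
This file is the kernel form of «the interaction term is NECESSARY for seventeen»: with `m ≡ 0` the two Schur branches decouple into two nine-nomials and the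
sheet count drops to `16`, one BELOW the stub's `17`, whatever the support and the inertia cell.  The sub-stratum is thin (codimension six); nothing here bounds
the generic sheet; `DoorA34` and all three stubs stay OPEN; registers unchanged (`ζ_sym(3,4) ∈ {18,19}`); nothing on `MatrixDescartes` (stmt-ValiantsHypothesis-18050)
or `VP ≠ VNP` — VP≠VNP not moved.  [folklore] Jacobi's complementary-minor identity over `ℝ[X]`, sparse Descartes
(`Literature.Computability.AlgebraicComplexity.card_roots_toFinset_filter_pos_lt_card_support`).
-/

-- `Summit.ValiantsHypothesis.ValiantsHypothesis.…` repeats a component by the D-0017 layout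
-- (single-conjunct summit), which the `dupNamespace` linter flags; the name is mandated.
set_option linter.dupNamespace false

namespace Summit.ValiantsHypothesis.ValiantsHypothesis.Theorems.LacunarySymmetroidMatrixDescartes.Census

open scoped BigOperators Matrix Polynomial
open Matrix Polynomial

/-! ## 1. Bookkeeping: the pencil as core plus two grafts over `ℝ[X]` -/

/-- `(a·vvᵀ + b·wwᵀ).map C = C a • v̂v̂ᵀ + C b • ŵŵᵀ` with `v̂ = C ∘ v`, `ŵ = C ∘ w`. [folklore] -/
theorem map_C_two_grafts (a b : ℝ) (v w : Fin 3 → ℝ) :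
    (a • Matrix.vecMulVec v v + b • Matrix.vecMulVec w w).map (C : ℝ → ℝ[X])
      = C a • Matrix.vecMulVec (fun i => C (v i)) (fun i => C (v i)) + C b • Matrix.vecMulVec (fun i => C (w i)) (fun i => C (w i)) := by
  ext i j
  simp only [Matrix.map_apply, Matrix.smul_apply, Matrix.add_apply, Matrix.vecMulVec_apply, smul_eq_mul, map_mul, map_add]

/-- **The `(3,4)` pencil with a two-graft top letter**: `P = G + (C a·X^{d₃})·v̂v̂ᵀ + (C b·X^{d₃})·ŵŵᵀ`. [folklore] -/
theorem pencil_two_grafts_eq (d : Fin 4 → ℕ) (S : Fin 4 → Matrix (Fin 3) (Fin 3) ℝ) (a b : ℝ) (v w : Fin 3 → ℝ)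
    (hS3 : S 3 = a • Matrix.vecMulVec v v + b • Matrix.vecMulVec w w) :
    (∑ l, ((X : ℝ[X]) ^ d l) • (S l).map C)
      = (∑ l : Fin 3, ((X : ℝ[X]) ^ d (Fin.castSucc l)) • (S (Fin.castSucc l)).map C)
        + (C a * (X : ℝ[X]) ^ d 3) • Matrix.vecMulVec (fun i => C (v i)) (fun i => C (v i))
        + (C b * (X : ℝ[X]) ^ d 3) • Matrix.vecMulVec (fun i => C (w i)) (fun i => C (w i)) := by
  rw [pencil_eq_core_add_top, hS3, map_C_two_grafts, smul_add, smul_smul, smul_smul, add_assoc]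
  congr 2 <;> ring_nf

/-! ## 2. The Gram entries of `adj P` on the frame, as polynomials -/

/-- Left diagonal Gram entry: `v̂ᵀ adj(P) v̂ = v̂ᵀ adj(G) v̂ + (C b·X^{d₃})·k̂ᵀGk̂`. [folklore] -/
theorem gramDiag_left_eq (d : Fin 4 → ℕ) (S : Fin 4 → Matrix (Fin 3) (Fin 3) ℝ) (a b : ℝ) (v w : Fin 3 → ℝ)
    (hS3 : S 3 = a • Matrix.vecMulVec v v + b • Matrix.vecMulVec w w) :
    ((fun i => C (v i)) ⬝ᵥ ((∑ l, ((X : ℝ[X]) ^ d l) • (S l).map C).adjugate *ᵥ fun i => C (v i)))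
      = ((fun i => C (v i)) ⬝ᵥ ((∑ l : Fin 3, ((X : ℝ[X]) ^ d (Fin.castSucc l)) • (S (Fin.castSucc l)).map C).adjugate *ᵥ fun i => C (v i)))
        + (C b * (X : ℝ[X]) ^ d 3) * ((fun i => C ((v ⨯₃ w) i)) ⬝ᵥ
            ((∑ l : Fin 3, ((X : ℝ[X]) ^ d (Fin.castSucc l)) • (S (Fin.castSucc l)).map C) *ᵥ fun i => C ((v ⨯₃ w) i))) := by
  rw [pencil_two_grafts_eq d S a b v w hS3, adjugate_quadForm_add_two_grafts_left, cross_map_C]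

/-- Right diagonal Gram entry: `ŵᵀ adj(P) ŵ = ŵᵀ adj(G) ŵ + (C a·X^{d₃})·k̂ᵀGk̂`. [folklore] -/
theorem gramDiag_right_eq (d : Fin 4 → ℕ) (S : Fin 4 → Matrix (Fin 3) (Fin 3) ℝ) (a b : ℝ) (v w : Fin 3 → ℝ)
    (hS3 : S 3 = a • Matrix.vecMulVec v v + b • Matrix.vecMulVec w w) :
    ((fun i => C (w i)) ⬝ᵥ ((∑ l, ((X : ℝ[X]) ^ d l) • (S l).map C).adjugate *ᵥ fun i => C (w i)))
      = ((fun i => C (w i)) ⬝ᵥ ((∑ l : Fin 3, ((X : ℝ[X]) ^ d (Fin.castSucc l)) • (S (Fin.castSucc l)).map C).adjugate *ᵥ fun i => C (w i)))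
        + (C a * (X : ℝ[X]) ^ d 3) * ((fun i => C ((v ⨯₃ w) i)) ⬝ᵥ
            ((∑ l : Fin 3, ((X : ℝ[X]) ^ d (Fin.castSucc l)) • (S (Fin.castSucc l)).map C) *ᵥ fun i => C ((v ⨯₃ w) i))) := by
  rw [pencil_two_grafts_eq d S a b v w hS3, adjugate_quadForm_add_two_grafts_right, cross_map_C]

/-- **The off-diagonal Gram entry is the core's**: `v̂ᵀ adj(P) ŵ = v̂ᵀ adj(G) ŵ` (graft-free; `d₃` does not occur). [folklore] -/
theorem gramOffDiag_eq_core (d : Fin 4 → ℕ) (S : Fin 4 → Matrix (Fin 3) (Fin 3) ℝ) (a b : ℝ) (v w : Fin 3 → ℝ)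
    (hS3 : S 3 = a • Matrix.vecMulVec v v + b • Matrix.vecMulVec w w) :
    ((fun i => C (v i)) ⬝ᵥ ((∑ l, ((X : ℝ[X]) ^ d l) • (S l).map C).adjugate *ᵥ fun i => C (w i)))
      = ((fun i => C (v i)) ⬝ᵥ ((∑ l : Fin 3, ((X : ℝ[X]) ^ d (Fin.castSucc l)) • (S (Fin.castSucc l)).map C).adjugate *ᵥ fun i => C (w i))) := by
  rw [pencil_two_grafts_eq d S a b v w hS3, adjugate_bilin_add_two_grafts]

/-- The transposed off-diagonal entry is the core's as well. [folklore] -/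
theorem gramOffDiag_eq_core' (d : Fin 4 → ℕ) (S : Fin 4 → Matrix (Fin 3) (Fin 3) ℝ) (a b : ℝ) (v w : Fin 3 → ℝ)
    (hS3 : S 3 = a • Matrix.vecMulVec v v + b • Matrix.vecMulVec w w) :
    ((fun i => C (w i)) ⬝ᵥ ((∑ l, ((X : ℝ[X]) ^ d l) • (S l).map C).adjugate *ᵥ fun i => C (v i)))
      = ((fun i => C (w i)) ⬝ᵥ ((∑ l : Fin 3, ((X : ℝ[X]) ^ d (Fin.castSucc l)) • (S (Fin.castSucc l)).map C).adjugate *ᵥ fun i => C (v i))) := by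
  rw [pencil_two_grafts_eq d S a b v w hS3, adjugate_bilin_add_two_grafts']

/-- The top form of the pencil is the core's: `k̂ᵀ P k̂ = k̂ᵀ G k̂` (`k = v × w` is killed by both grafts). [folklore] -/
theorem topForm_eq_core (d : Fin 4 → ℕ) (S : Fin 4 → Matrix (Fin 3) (Fin 3) ℝ) (a b : ℝ) (v w : Fin 3 → ℝ)
    (hS3 : S 3 = a • Matrix.vecMulVec v v + b • Matrix.vecMulVec w w) :
    ((fun i => C ((v ⨯₃ w) i)) ⬝ᵥ ((∑ l, ((X : ℝ[X]) ^ d l) • (S l).map C) *ᵥ fun i => C ((v ⨯₃ w) i)))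
      = ((fun i => C ((v ⨯₃ w) i)) ⬝ᵥ
          ((∑ l : Fin 3, ((X : ℝ[X]) ^ d (Fin.castSucc l)) • (S (Fin.castSucc l)).map C) *ᵥ fun i => C ((v ⨯₃ w) i))) := by
  rw [pencil_two_grafts_eq d S a b v w hS3, ← cross_map_C, cross_quadForm_add_two_grafts]

/-- **JACOBI ON THE SHEET, polynomial form**: `(v̂ᵀadj P v̂)(ŵᵀadj P ŵ) − (v̂ᵀadj G ŵ)(ŵᵀadj G v̂) = det P · k̂ᵀGk̂`. [folklore] -/
theorem gram_identity_pencil (d : Fin 4 → ℕ) (S : Fin 4 → Matrix (Fin 3) (Fin 3) ℝ) (a b : ℝ) (v w : Fin 3 → ℝ)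
    (hS3 : S 3 = a • Matrix.vecMulVec v v + b • Matrix.vecMulVec w w) :
    ((fun i => C (v i)) ⬝ᵥ ((∑ l, ((X : ℝ[X]) ^ d l) • (S l).map C).adjugate *ᵥ fun i => C (v i)))
        * ((fun i => C (w i)) ⬝ᵥ ((∑ l, ((X : ℝ[X]) ^ d l) • (S l).map C).adjugate *ᵥ fun i => C (w i)))
      - ((fun i => C (v i)) ⬝ᵥ ((∑ l : Fin 3, ((X : ℝ[X]) ^ d (Fin.castSucc l)) • (S (Fin.castSucc l)).map C).adjugate *ᵥ fun i => C (w i)))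
        * ((fun i => C (w i)) ⬝ᵥ ((∑ l : Fin 3, ((X : ℝ[X]) ^ d (Fin.castSucc l)) • (S (Fin.castSucc l)).map C).adjugate *ᵥ fun i => C (v i)))
      = (∑ l, ((X : ℝ[X]) ^ d l) • (S l).map C).det
        * ((fun i => C ((v ⨯₃ w) i)) ⬝ᵥ
            ((∑ l : Fin 3, ((X : ℝ[X]) ^ d (Fin.castSucc l)) • (S (Fin.castSucc l)).map C) *ᵥ fun i => C ((v ⨯₃ w) i))) := by
  rw [← gramOffDiag_eq_core d S a b v w hS3, ← gramOffDiag_eq_core' d S a b v w hS3, ← topForm_eq_core d S a b v w hS3, ← cross_map_C]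
  exact adjugate_gram_fin_three _ _ _

/-! ## 3. Supports: each diagonal Gram entry is a nine-nomial -/

/-- The support of `C c · X^n · p` sits in the support of `p` shifted by `n`. [folklore] -/
theorem support_C_mul_X_pow_mul_subset (c : ℝ) (n : ℕ) (p : ℝ[X]) (s : Finset ℕ) (hp : p.support ⊆ s) :
    (C c * (X : ℝ[X]) ^ n * p).support ⊆ s.image (fun e => n + e) := by
  intro e he
  rw [Polynomial.mem_support_iff, mul_assoc, Polynomial.coeff_C_mul, Polynomial.coeff_X_pow_mul'] at he
  by_cases hle : n ≤ e
  · rw [if_pos hle] at he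
    have hmem : e - n ∈ p.support := Polynomial.mem_support_iff.mpr (fun h0 => he (by rw [h0, mul_zero]))
    exact Finset.mem_image.mpr ⟨e - n, hp hmem, by omega⟩
  · exact absurd (by rw [if_neg hle, mul_zero]) he

/-- **The left diagonal Gram entry is a nine-nomial**: support ⊆ (pair sums of the core) ∪ (`d₃ +` singles). [folklore] -/
theorem support_gramDiag_left_subset (d : Fin 4 → ℕ) (S : Fin 4 → Matrix (Fin 3) (Fin 3) ℝ) (a b : ℝ) (v w : Fin 3 → ℝ)
    (hS3 : S 3 = a • Matrix.vecMulVec v v + b • Matrix.vecMulVec w w) :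
    ((fun i => C (v i)) ⬝ᵥ ((∑ l, ((X : ℝ[X]) ^ d l) • (S l).map C).adjugate *ᵥ fun i => C (v i))).support
      ⊆ (Finset.univ : Finset (Fin 2 → Fin 3)).image (fun f => ∑ i, d (Fin.castSucc (f i)))
        ∪ (Finset.univ : Finset (Fin 3)).image (fun l => d 3 + d (Fin.castSucc l)) := by
  rw [gramDiag_left_eq d S a b v w hS3]
  refine (Polynomial.support_add).trans (Finset.union_subset_union (support_middleBlock_subset d S v v) ?_)
  have h := support_C_mul_X_pow_mul_subset b (d 3) _ _ (support_topBlock_subset d S (v ⨯₃ w))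
  rw [Finset.image_image] at h
  exact h

/-- **The right diagonal Gram entry is a nine-nomial.** [folklore] -/
theorem support_gramDiag_right_subset (d : Fin 4 → ℕ) (S : Fin 4 → Matrix (Fin 3) (Fin 3) ℝ) (a b : ℝ) (v w : Fin 3 → ℝ)
    (hS3 : S 3 = a • Matrix.vecMulVec v v + b • Matrix.vecMulVec w w) :
    ((fun i => C (w i)) ⬝ᵥ ((∑ l, ((X : ℝ[X]) ^ d l) • (S l).map C).adjugate *ᵥ fun i => C (w i))).support
      ⊆ (Finset.univ : Finset (Fin 2 → Fin 3)).image (fun f => ∑ i, d (Fin.castSucc (f i)))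
        ∪ (Finset.univ : Finset (Fin 3)).image (fun l => d 3 + d (Fin.castSucc l)) := by
  rw [gramDiag_right_eq d S a b v w hS3]
  refine (Polynomial.support_add).trans (Finset.union_subset_union (support_middleBlock_subset d S w w) ?_)
  have h := support_C_mul_X_pow_mul_subset a (d 3) _ _ (support_topBlock_subset d S (v ⨯₃ w))
  rw [Finset.image_image] at h
  exact h

/-- The nine-exponent set has at most nine elements. [folklore] -/
theorem card_nineExponents_le (d : Fin 4 → ℕ) :
    ((Finset.univ : Finset (Fin 2 → Fin 3)).image (fun f => ∑ i, d (Fin.castSucc (f i)))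
        ∪ (Finset.univ : Finset (Fin 3)).image (fun l => d 3 + d (Fin.castSucc l))).card ≤ 9 := by
  refine (Finset.card_union_le _ _).trans ?_
  have h1 := card_pairSums_three_le (fun l : Fin 3 => d (Fin.castSucc l))
  have h2 : ((Finset.univ : Finset (Fin 3)).image (fun l => d 3 + d (Fin.castSucc l))).card ≤ 3 :=
    Finset.card_image_le.trans (by simp)
  omega

/-- A polynomial supported on the nine-exponent set has at most EIGHT distinct positive roots (sparse Descartes). [folklore] -/
theorem card_posRoots_le_eight_of_support_nine (d : Fin 4 → ℕ) (p : ℝ[X]) (hp : p ≠ 0)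
    (hs : p.support ⊆ (Finset.univ : Finset (Fin 2 → Fin 3)).image (fun f => ∑ i, d (Fin.castSucc (f i)))
        ∪ (Finset.univ : Finset (Fin 3)).image (fun l => d 3 + d (Fin.castSucc l))) :
    (p.roots.toFinset.filter (fun t => 0 < t)).card ≤ 8 := by
  have h1 := Literature.Computability.AlgebraicComplexity.card_roots_toFinset_filter_pos_lt_card_support hp
  have h2 : p.support.card ≤ 9 := (Finset.card_le_card hs).trans (card_nineExponents_le d)
  omega

/-! ## 4. NO SEVENTEEN WITHOUT THE INTERACTION TERM -/

/-- **DECOUPLED FRAME ⇒ `≤ 16`.**  A real symmetric `(3,4)` pencil `P = Σ_l X^{d_l} S_l` whose top letter is two rank-one grafts `S₃ = a·vvᵀ + b·wwᵀ`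
(either inertia cell; any support `d`), such that the interaction term VANISHES identically — `v̂ᵀ adj(G(X)) ŵ = 0` for the three-letter core `G` — and
whose two diagonal Gram entries `v̂ᵀ adj(P) v̂`, `ŵᵀ adj(P) ŵ` are not the zero polynomial: then `det P` has at most `16` distinct positive roots.
(Jacobi: `det P · k̂ᵀGk̂ = A·B`, so every positive det-root is a root of one of the two nine-nomials.) [folklore] -/
theorem card_posRoots_le_16_of_decoupledFrame' (d : Fin 4 → ℕ) (S : Fin 4 → Matrix (Fin 3) (Fin 3) ℝ) (a b : ℝ) (v w : Fin 3 → ℝ)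
    (hS3 : S 3 = a • Matrix.vecMulVec v v + b • Matrix.vecMulVec w w)
    (hm : ((fun i => C (v i)) ⬝ᵥ ((∑ l : Fin 3, ((X : ℝ[X]) ^ d (Fin.castSucc l)) • (S (Fin.castSucc l)).map C).adjugate *ᵥ fun i => C (w i))) = 0)
    (hA : ((fun i => C (v i)) ⬝ᵥ ((∑ l, ((X : ℝ[X]) ^ d l) • (S l).map C).adjugate *ᵥ fun i => C (v i))) ≠ 0)
    (hB : ((fun i => C (w i)) ⬝ᵥ ((∑ l, ((X : ℝ[X]) ^ d l) • (S l).map C).adjugate *ᵥ fun i => C (w i))) ≠ 0) :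
    ((∑ l, ((X : ℝ[X]) ^ d l) • (S l).map C).det.roots.toFinset.filter (fun t => 0 < t)).card ≤ 16 := by
  set P := (∑ l, ((X : ℝ[X]) ^ d l) • (S l).map C) with hP
  set A := ((fun i => C (v i)) ⬝ᵥ (P.adjugate *ᵥ fun i => C (v i))) with hA'
  set B := ((fun i => C (w i)) ⬝ᵥ (P.adjugate *ᵥ fun i => C (w i))) with hB'
  -- Jacobi with the interaction term erased: `A * B = det P * T`
  have hjac := gram_identity_pencil d S a b v w hS3
  rw [hm, zero_mul, sub_zero] at hjac
  -- every positive det-root is a root of `A` or of `B`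
  have hsub : P.det.roots.toFinset.filter (fun t => 0 < t)
      ⊆ A.roots.toFinset.filter (fun t => 0 < t) ∪ B.roots.toFinset.filter (fun t => 0 < t) := by
    intro r hr
    rw [Finset.mem_filter, Multiset.mem_toFinset] at hr
    obtain ⟨hroot, hpos⟩ := hr
    have hdet0 : P.det.eval r = 0 := (Polynomial.mem_roots'.mp hroot).2
    have hAB : A.eval r * B.eval r = 0 := by
      have := congrArg (Polynomial.eval r) hjac
      rw [Polynomial.eval_mul, Polynomial.eval_mul, hdet0, zero_mul] at this
      exact this
    rcases mul_eq_zero.mp hAB with h0 | h0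
    · exact Finset.mem_union_left _ (Finset.mem_filter.mpr ⟨Multiset.mem_toFinset.mpr (Polynomial.mem_roots'.mpr ⟨hA, h0⟩), hpos⟩)
    · exact Finset.mem_union_right _ (Finset.mem_filter.mpr ⟨Multiset.mem_toFinset.mpr (Polynomial.mem_roots'.mpr ⟨hB, h0⟩), hpos⟩)
  have hcA := card_posRoots_le_eight_of_support_nine d A hA (support_gramDiag_left_subset d S a b v w hS3)
  have hcB := card_posRoots_le_eight_of_support_nine d B hB (support_gramDiag_right_subset d S a b v w hS3)
  calc (P.det.roots.toFinset.filter (fun t => 0 < t)).card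
      ≤ (A.roots.toFinset.filter (fun t => 0 < t) ∪ B.roots.toFinset.filter (fun t => 0 < t)).card := Finset.card_le_card hsub
    _ ≤ (A.roots.toFinset.filter (fun t => 0 < t)).card + (B.roots.toFinset.filter (fun t => 0 < t)).card := Finset.card_union_le _ _
    _ ≤ 16 := by omega

/-- **NO SEVENTEEN WITHOUT THE INTERACTION TERM** (stub-shaped binders).  For a real `(3,4)` pencil with `S 3 = a·vvᵀ + b·wwᵀ` on ANY support `d`:
if the core's frame off-diagonal `v̂ᵀ adj(Σ_{l<3} X^{d_l} S_l) ŵ` is the zero polynomial and the two diagonal Gram nine-nomials are non-zero, then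
`Z₊(det Σ_l X^{d_l} S_l) ≤ 16 < 17`.  (No symmetry, inertia-cell or ordering hypothesis is needed.) [folklore] -/
theorem card_posRoots_le_16_of_decoupledFrame (d : Fin 4 → ℕ) (S : Fin 4 → Matrix (Fin 3) (Fin 3) ℝ) (a b : ℝ) (v w : Fin 3 → ℝ)
    (hS3 : S 3 = a • Matrix.vecMulVec v v + b • Matrix.vecMulVec w w)
    (hm : ((fun i => C (v i)) ⬝ᵥ ((∑ l : Fin 3, ((X : ℝ[X]) ^ d (Fin.castSucc l)) • (S (Fin.castSucc l)).map C).adjugate *ᵥ fun i => C (w i))) = 0)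
    (hA : ((fun i => C (v i)) ⬝ᵥ ((∑ l, ((X : ℝ[X]) ^ d l) • (S l).map C).adjugate *ᵥ fun i => C (v i))) ≠ 0)
    (hB : ((fun i => C (w i)) ⬝ᵥ ((∑ l, ((X : ℝ[X]) ^ d l) • (S l).map C).adjugate *ᵥ fun i => C (w i))) ≠ 0) :
    ((∑ l, (Polynomial.X : Polynomial ℝ) ^ d l • (S l).map Polynomial.C).det.roots.toFinset.filter (fun t => 0 < t)).card ≤ 16 :=
  card_posRoots_le_16_of_decoupledFrame' d S a b v w hS3 hm hA hB

/-! ## 5. (rev 2, val-sym-eng-2 g10) The degenerate corners: the count `≤ 16` WITHOUT the non-degeneracy hypotheses `A ≠ 0`, `B ≠ 0` -/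

/-- The isotropic-kernel corner: if the top form `k̂ᵀGk̂` of the core VANISHES identically (`k = v × w`), the `(3,4)` pencil with top letter
`a·vvᵀ + b·wwᵀ` loses its whole top window — `det P = det G + X^{d₃}·(C a·v̂ᵀadjG v̂ + C b·ŵᵀadjG ŵ)` — so `supp(det P) ⊆` (triple sums of the core)
`∪ (d₃ +` pair sums of the core`)`, at most `16` monomials. [folklore] -/
theorem support_det_subset_of_topForm_eq_zero (d : Fin 4 → ℕ) (S : Fin 4 → Matrix (Fin 3) (Fin 3) ℝ) (a b : ℝ) (v w : Fin 3 → ℝ)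
    (hS3 : S 3 = a • Matrix.vecMulVec v v + b • Matrix.vecMulVec w w)
    (hT : ((fun i => C ((v ⨯₃ w) i)) ⬝ᵥ
        ((∑ l : Fin 3, ((X : ℝ[X]) ^ d (Fin.castSucc l)) • (S (Fin.castSucc l)).map C) *ᵥ fun i => C ((v ⨯₃ w) i))) = 0) :
    (∑ l, ((X : ℝ[X]) ^ d l) • (S l).map C).det.support
      ⊆ (Finset.univ : Finset (Sym (Fin 3) 3)).image
          (fun s : Sym (Fin 3) 3 => ((s : Multiset (Fin 3)).map (fun l => d (Fin.castSucc l))).sum)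
        ∪ (Finset.univ : Finset (Fin 2 → Fin 3)).image (fun f => d 3 + ∑ i, d (Fin.castSucc (f i))) := by
  -- the determinant as core + two grafts, top window killed by `hT`
  have hdet : (∑ l, ((X : ℝ[X]) ^ d l) • (S l).map C).det
      = (∑ l : Fin 3, ((X : ℝ[X]) ^ d (Fin.castSucc l)) • (S (Fin.castSucc l)).map C).det
        + (X : ℝ[X]) ^ d 3 * (C a * ((fun i => C (v i)) ⬝ᵥ
            ((∑ l : Fin 3, ((X : ℝ[X]) ^ d (Fin.castSucc l)) • (S (Fin.castSucc l)).map C).adjugate *ᵥ fun i => C (v i)))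
          + C b * ((fun i => C (w i)) ⬝ᵥ
            ((∑ l : Fin 3, ((X : ℝ[X]) ^ d (Fin.castSucc l)) • (S (Fin.castSucc l)).map C).adjugate *ᵥ fun i => C (w i)))) := by
    rw [pencil_two_grafts_eq d S a b v w hS3, det_add_two_smul_vecMulVec_fin_three, cross_map_C, hT, mul_zero, add_zero]
    ring
  intro n hn
  rw [hdet] at hn
  rcases Finset.mem_union.mp (Polynomial.support_add hn) with hcore | hmid
  · exact Finset.mem_union_left _
      (StubDescartesCeiling.support_det_pencil_subset (fun l : Fin 3 => d (Fin.castSucc l)) (fun l => S (Fin.castSucc l)) hcore)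
  · refine Finset.mem_union_right _ ?_
    rw [Polynomial.mem_support_iff, Polynomial.coeff_X_pow_mul'] at hmid
    split_ifs at hmid with hle
    · have hmem : n - d 3 ∈ (Finset.univ : Finset (Fin 2 → Fin 3)).image (fun f => ∑ i, d (Fin.castSucc (f i))) := by
        by_contra hni
        apply hmid
        have hv0 : (((fun i => C (v i)) ⬝ᵥ ((∑ l : Fin 3, ((X : ℝ[X]) ^ d (Fin.castSucc l)) • (S (Fin.castSucc l)).map C).adjugate *ᵥ
            fun i => C (v i)))).coeff (n - d 3) = 0 :=
          Polynomial.notMem_support_iff.mp fun h => hni (support_middleBlock_subset d S v v h)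
        have hw0 : (((fun i => C (w i)) ⬝ᵥ ((∑ l : Fin 3, ((X : ℝ[X]) ^ d (Fin.castSucc l)) • (S (Fin.castSucc l)).map C).adjugate *ᵥ
            fun i => C (w i)))).coeff (n - d 3) = 0 :=
          Polynomial.notMem_support_iff.mp fun h => hni (support_middleBlock_subset d S w w h)
        rw [Polynomial.coeff_add, Polynomial.coeff_C_mul, Polynomial.coeff_C_mul, hv0, hw0, mul_zero, mul_zero, add_zero]
      obtain ⟨f, hf, hfs⟩ := Finset.mem_image.mp hmem
      exact Finset.mem_image.mpr ⟨f, hf, by omega⟩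
    · exact absurd rfl hmid

/-- At most `16` exponents in the isotropic-kernel corner. [folklore] -/
theorem card_sixteenExponents_le (d : Fin 4 → ℕ) :
    ((Finset.univ : Finset (Sym (Fin 3) 3)).image
          (fun s : Sym (Fin 3) 3 => ((s : Multiset (Fin 3)).map (fun l => d (Fin.castSucc l))).sum)
        ∪ (Finset.univ : Finset (Fin 2 → Fin 3)).image (fun f => d 3 + ∑ i, d (Fin.castSucc (f i)))).card ≤ 16 := by
  refine (Finset.card_union_le _ _).trans ?_
  have h10 : ((Finset.univ : Finset (Sym (Fin 3) 3)).image
      (fun s : Sym (Fin 3) 3 => ((s : Multiset (Fin 3)).map (fun l => d (Fin.castSucc l))).sum)).card ≤ 10 :=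
    Finset.card_image_le.trans (by rw [Finset.card_univ, Sym.card_sym_eq_choose]; decide)
  have h6 : ((Finset.univ : Finset (Fin 2 → Fin 3)).image (fun f => d 3 + ∑ i, d (Fin.castSucc (f i)))).card ≤ 6 := by
    have h := card_pairSums_three_le (fun l : Fin 3 => d (Fin.castSucc l))
    have : (Finset.univ : Finset (Fin 2 → Fin 3)).image (fun f => d 3 + ∑ i, d (Fin.castSucc (f i)))
        = ((Finset.univ : Finset (Fin 2 → Fin 3)).image (fun f => ∑ i, d (Fin.castSucc (f i)))).image (fun n => d 3 + n) := by
      rw [Finset.image_image]; rfl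
    rw [this]
    exact Finset.card_image_le.trans h
  omega

/-- **Isotropic-kernel corner ⇒ `≤ 15`**: if `k̂ᵀGk̂ ≡ 0` the determinant has at most `16` monomials, hence at most `15` distinct positive roots
(sparse Descartes). [folklore] -/
theorem card_posRoots_le_15_of_topForm_eq_zero (d : Fin 4 → ℕ) (S : Fin 4 → Matrix (Fin 3) (Fin 3) ℝ) (a b : ℝ) (v w : Fin 3 → ℝ)
    (hS3 : S 3 = a • Matrix.vecMulVec v v + b • Matrix.vecMulVec w w)
    (hT : ((fun i => C ((v ⨯₃ w) i)) ⬝ᵥ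
        ((∑ l : Fin 3, ((X : ℝ[X]) ^ d (Fin.castSucc l)) • (S (Fin.castSucc l)).map C) *ᵥ fun i => C ((v ⨯₃ w) i))) = 0) :
    ((∑ l, ((X : ℝ[X]) ^ d l) • (S l).map C).det.roots.toFinset.filter (fun t => 0 < t)).card ≤ 15 := by
  by_cases hP : (∑ l, ((X : ℝ[X]) ^ d l) • (S l).map C).det = 0
  · rw [hP, Polynomial.roots_zero, Multiset.toFinset_zero, Finset.filter_empty, Finset.card_empty]; omega
  have hlt := Literature.Computability.AlgebraicComplexity.card_roots_toFinset_filter_pos_lt_card_support hP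
  have hc := (Finset.card_le_card (support_det_subset_of_topForm_eq_zero d S a b v w hS3 hT)).trans (card_sixteenExponents_le d)
  omega

/-- **NO SEVENTEEN WITHOUT THE INTERACTION TERM — closed form (rev 2).**  For a real `(3,4)` pencil with `S 3 = a·vvᵀ + b·wwᵀ` on ANY support:
if the interaction term `v̂ᵀ adj(G(X)) ŵ` of the three-letter core vanishes identically, then `Z₊(det Σ_l X^{d_l} S_l) ≤ 16` — with NO non-degeneracy
hypothesis.  (If a diagonal Gram nine-nomial vanishes, Jacobi `A·B = det P·k̂ᵀGk̂` forces `det P ≡ 0` (no roots) or `k̂ᵀGk̂ ≡ 0`, the isotropic-kernel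
corner with `≤ 15` by `card_posRoots_le_15_of_topForm_eq_zero`.) [folklore] -/
theorem card_posRoots_le_16_of_decoupledFrame_closed (d : Fin 4 → ℕ) (S : Fin 4 → Matrix (Fin 3) (Fin 3) ℝ) (a b : ℝ) (v w : Fin 3 → ℝ)
    (hS3 : S 3 = a • Matrix.vecMulVec v v + b • Matrix.vecMulVec w w)
    (hm : ((fun i => C (v i)) ⬝ᵥ ((∑ l : Fin 3, ((X : ℝ[X]) ^ d (Fin.castSucc l)) • (S (Fin.castSucc l)).map C).adjugate *ᵥ fun i => C (w i))) = 0) :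
    ((∑ l, (Polynomial.X : Polynomial ℝ) ^ d l • (S l).map Polynomial.C).det.roots.toFinset.filter (fun t => 0 < t)).card ≤ 16 := by
  by_cases hA : ((fun i => C (v i)) ⬝ᵥ ((∑ l, ((X : ℝ[X]) ^ d l) • (S l).map C).adjugate *ᵥ fun i => C (v i))) = 0
  case neg =>
    by_cases hB : ((fun i => C (w i)) ⬝ᵥ ((∑ l, ((X : ℝ[X]) ^ d l) • (S l).map C).adjugate *ᵥ fun i => C (w i))) = 0
    case neg => exact card_posRoots_le_16_of_decoupledFrame' d S a b v w hS3 hm hA hB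
    case pos =>
      -- `B = 0`: Jacobi gives `det P · T = 0`
      have hjac := gram_identity_pencil d S a b v w hS3
      rw [hm, zero_mul, sub_zero, hB, mul_zero] at hjac
      rcases mul_eq_zero.mp hjac.symm with hP | hT
      · rw [hP, Polynomial.roots_zero, Multiset.toFinset_zero, Finset.filter_empty, Finset.card_empty]; omega
      · exact (card_posRoots_le_15_of_topForm_eq_zero d S a b v w hS3 hT).trans (by norm_num)
  case pos =>
    have hjac := gram_identity_pencil d S a b v w hS3
    rw [hm, zero_mul, sub_zero, hA, zero_mul] at hjac
    rcases mul_eq_zero.mp hjac.symm with hP | hT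
    · rw [hP, Polynomial.roots_zero, Multiset.toFinset_zero, Finset.filter_empty, Finset.card_empty]; omega
    · exact (card_posRoots_le_15_of_topForm_eq_zero d S a b v w hS3 hT).trans (by norm_num)

end Summit.ValiantsHypothesis.ValiantsHypothesis.Theorems.LacunarySymmetroidMatrixDescartes.Census
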